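import Literature.NumberTheory.LFunctions.RademacherDirichletLConvexity
import HarnessLib

/-!
# Platt's critical-line bound for `L_χ` (Math. Comp. 85 (2016) §7.2, Lemma 7.3) from Rademacher

Topic `Literature/NumberTheory/LFunctions`; namespace `Literature.NumberTheory.LFunctions`. PROVED (no
named fact, no definition). Typed for the parity-realchar cell (D-0088 (4) literature-typing layer,
row «Platt 2016 (Math. Comp., certified GRH/`L`-function computations)»): instrument provenance for
"Algorithm 2" (§7: Booker's rigorous FFT method specialised to Dirichlet `L`-functions) of Platt's GRH
verification `Literature.NumberTheory.LFunctions.platt2016_theorem71/72`. The one analytic input of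
§7.2 ("Approximating `F̃̂` with `F̂`") and of the truncation bound Lemma 8.7 that is a theorem about
`L`-functions rather than about the algorithm is

  **Lemma 7.3.** For `t ∈ ℝ`, `|L_χ(1/2 + it)| ≤ ζ(9/8) (q/2π)^{5/16} (3/2 + |t|)^{5/16}`,

"Proof. We evaluate Rademacher's bound [14] `|L_χ(s)| ≤ ζ(1+ν) (q|1+s|/2π)^{(1+ν-Re s)/2}` with
`ν = 1/8` and `s = 1/2 + it`." Rademacher's bound (Math. Z. 72 (1959), Theorem 3 p. 199; primitive
`χ` modulo `q > 1`, `0 < ν ≤ 1/2`, `-ν ≤ Re s ≤ 1 + ν`) is a THEOREM of the tree,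
`Literature.NumberTheory.LFunctions.Rademacher1959.norm_LFunction_le`
(`RademacherDirichletLConvexity.lean`), so Lemma 7.3 is proved here by exactly the printed
specialisation plus `|1 + s| = |3/2 + it| ≤ 3/2 + |t|`.

Conventions: `L_χ(s) = DirichletCharacter.LFunction χ s` (Mathlib); `χ` primitive modulo `q > 1`
(Platt's setting: primitive characters, `q ≥ 3`); `ζ(9/8)` is the real number
`Booker2006Turing.bigZ (9/8) = (riemannZeta (9/8)).re` (the tree's notation for real zeta values,
`CertifiedDirichletLTuringMethod.lean`).

NOT here — the rest of §7 is PROVED in companion files (state 2026-08-27): Lemmas 7.1–7.2 (the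
theta-series expansions of `F̂_e`, `F̂_o` by Mellin inversion and a contour shift) in
`CertifiedLFunctionFourierTheta.lean` (`platt2016_lemma71`, `platt2016_lemma72`); Lemma 7.4
(= Booker 2006 Exp. Math. Lemma 5.6 specialised) and Lemma 7.5 in
`CertifiedLFunctionFourierTail.lean` (`platt2016_lemma74`, `_even`, `_odd`,
`platt2016_lemma75_even`, `_odd`; their realness hypothesis on `ε_χ` is discharged in
`CertifiedLFunctionRealPhase.lean`); Lemma 7.6 (= Booker's Lemma 5.7 with Lemma 7.3; majorant
stated with the `(3/2 + |t|)^{5/16}` this lemma delivers in place of the printed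
`|3/2 + t|^{5/16}`) in `CertifiedLFunctionTimeAliasingBound.lean` (`platt2016_lemma76`, `_even`,
`_odd`), and Booker's Lemma 5.7 verbatim for Dirichlet `L` in
`CertifiedLFunctionTimeAliasingBooker.lean`. Further companions: `CertifiedLFunctionDFTPair.lean`
(Thm 3.2), `CertifiedLFunctionHurwitzTaylor.lean` (Lemmas 6.2–6.3),
`CertifiedLFunctionUpsampling.lean` (Thms 8.1–8.2), `CertifiedLFunctionGammaFactorBound.lean`
(Lemma 8.3), `CertifiedLFunctionGaussianWindow.lean` (Lemma 8.4),
`CertifiedLFunctionWindowAliasingBound.lean` (Lemma 8.5), `CertifiedLFunctionUpsamplingTruncation.lean`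
(Lemmas 8.6–8.7 — the truncation bound this lemma feeds, `platt2016_lemma87`, via
`UpsamplingTruncation.norm_completedL_le` = "combine Lemmas 7.3, 8.3").

## References

* [Platt2016GRH] D. J. Platt, *Numerical computations concerning the GRH*, Math. Comp. 85 (2016),
  no. 302, 3009–3027, doi:10.1090/mcom/3077: §7.2 Lemma 7.3 p. 3019 (arXiv:1305.3087v1 Lemma 5.3).
* [Rademacher1959] H. Rademacher, *On the Phragmén–Lindelöf theorem and some applications*,
  Math. Z. 72 (1959) 192–204, Theorem 3 (Platt's reference [14]).
-/

noncomputable section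

open Complex DirichletCharacter
open scoped Real

namespace Literature.NumberTheory.LFunctions

/-- **Platt 2016, Lemma 7.3 (Math. Comp. 85, p. 3019; arXiv:1305.3087v1 Lemma 5.3), as printed:** "For
`t ∈ ℝ` we have `|L_χ(1/2 + it)| ≤ ζ(9/8) (q/2π)^{5/16} (3/2 + |t|)^{5/16}`. *Proof.* We evaluate
Rademacher's bound `|L_χ(s)| ≤ ζ(1+ν) (q|1+s|/2π)^{(1+ν-Re s)/2}` with `ν = 1/8` and `s = 1/2 + it`."
Here `χ` is a primitive character modulo `q > 1` (the characters of Platt's §7), `L_χ` = Mathlib's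
`DirichletCharacter.LFunction χ`, `ζ(9/8) = Booker2006Turing.bigZ (9/8) = (riemannZeta (9/8)).re`;
Rademacher's bound is the tree's theorem `Rademacher1959.norm_LFunction_le` (Math. Z. 72 (1959)
Thm 3), and `|1 + s| = |3/2 + it| ≤ 3/2 + |t|`. [cite: Platt2016GRH, Lemma 7.3 p. 3019] -/
theorem platt2016_lemma73 {q : ℕ} [NeZero q] (hq : 1 < q) {χ : DirichletCharacter ℂ q}
    (hχ : χ.IsPrimitive) (t : ℝ) :
    ‖χ.LFunction (1 / 2 + t * I)‖ ≤
      Booker2006Turing.bigZ (9 / 8) * ((q : ℝ) / (2 * π)) ^ ((5 : ℝ) / 16) *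
        (3 / 2 + |t|) ^ ((5 : ℝ) / 16) := by
  have h := Rademacher1959.norm_LFunction_le hq hχ (η := 1 / 8) (by norm_num) (by norm_num)
    (s := 1 / 2 + t * I) (by simp; norm_num) (by simp; norm_num)
  have hre : (1 / 2 + (t : ℂ) * I).re = 1 / 2 := by simp
  rw [hre, show (1 + 1 / 8 - 1 / 2 : ℝ) / 2 = (5 : ℝ) / 16 by norm_num] at h
  have hζ : (riemannZeta (1 + (1 / 8 : ℝ))).re = Booker2006Turing.bigZ (9 / 8) := by
    rw [Booker2006Turing.bigZ]; push_cast; norm_num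
  rw [hζ] at h
  have hn : ‖1 + (1 / 2 + (t : ℂ) * I)‖ ≤ 3 / 2 + |t| := by
    calc ‖1 + (1 / 2 + (t : ℂ) * I)‖ = ‖((3 / 2 : ℝ) : ℂ) + t * I‖ := by
          congr 1; push_cast; ring
      _ ≤ ‖((3 / 2 : ℝ) : ℂ)‖ + ‖(t : ℂ) * I‖ := norm_add_le _ _
      _ = 3 / 2 + |t| := by
          rw [Complex.norm_real, norm_mul, Complex.norm_I, mul_one, Complex.norm_real,
            Real.norm_eq_abs, Real.norm_eq_abs, abs_of_pos (by norm_num : (0 : ℝ) < 3 / 2)]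
  have hZ : 0 < Booker2006Turing.bigZ (9 / 8) := Booker2006Turing.bigZ_pos (by norm_num)
  have hqpos : (0 : ℝ) < q := by exact_mod_cast (by omega : 0 < q)
  calc ‖χ.LFunction (1 / 2 + t * I)‖
      ≤ (q * ‖1 + (1 / 2 + (t : ℂ) * I)‖ / (2 * π)) ^ ((5 : ℝ) / 16) *
          Booker2006Turing.bigZ (9 / 8) := h
    _ ≤ (q * (3 / 2 + |t|) / (2 * π)) ^ ((5 : ℝ) / 16) * Booker2006Turing.bigZ (9 / 8) := by
        gcongr
    _ = Booker2006Turing.bigZ (9 / 8) * ((q : ℝ) / (2 * π)) ^ ((5 : ℝ) / 16) *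
          (3 / 2 + |t|) ^ ((5 : ℝ) / 16) := by
        rw [show (q : ℝ) * (3 / 2 + |t|) / (2 * π) = (q / (2 * π)) * (3 / 2 + |t|) by ring,
          Real.mul_rpow (by positivity) (by positivity)]
        ring

end Literature.NumberTheory.LFunctions

end
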